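import Literature.MathematicalPhysics.QuantumFieldTheory.Balaban1983to89.B11Prop6Concrete
import Literature.MathematicalPhysics.QuantumFieldTheory.Balaban1983to89.T3PrintedRegularMinimiser
import Summits.QuantumFields.YangMills.Theorems.UnitScaleTiltProp7SectET3Transport
import HarnessLib

/-!
# Route `UnitScaleTilt`, crux K1 child «MinimiserStabilityRegPr» (stmt-QuantumFields-19200), stub `stub_existenceMinimalOrbit` (EX), route (α) —
# (S2-obj) + P6@T³: THE ROUTE'S BACKGROUND `U₀ : GaugeField (F.P K) 0 SU(2)` READ IN lit-balaban's (115) LETTERS AT d = 3, THE (14)-CURRENT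
# CLAUSE FROM `RegPr`, AND [Balaban1985Variational] PROPOSITION 6 AT THESE OBJECTS with the curved letters `𝔊(U₀)`, `(δ/δA′)V`, `H₁(U₀)` DISPLAYED

Cell `ym3-torus`, width seat `ym-ust-19200-w2` (gen 2; OWNER RULING g25-№1 §C/(S2)–(S3), RULING g25-№2, DE-CONFLICT 2026-08-28T01:54Z: «w2-19200 g2 = (S2-obj) +
P6@T³ + (S3)»; the SITE CHART itself is ★w5-20520's `Prop7SectET3Transport` — here it is an ABSTRACT shift-compatible equivalence `e`).  YM₃ on T³ is a ladder rung
(R3), not the Clay problem; nothing here is a claim about the stub, the crux, d = 4 or the mass gap.  `--supports stmt-QuantumFields-19200 --as helper`; count-neutral.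

THE PRINT.  [Balaban1985Variational] (2) p. 278: *«|(D*_U∂U)(b)| < ε₀L^{−2j}(Lʲη)⁻¹ = ε₀η²(Lʲη)⁻³ for b ∈ Ω_j»*; (14) p. 280: *«U₀ ∈ 𝔘_k({Ω_j}, C₁B₃ε₁)»*; Prop. 6
p. 295: *«There exists a positive, absolute constant a₄ such, that for ε₄ ≤ a₄ and ε₁ satisfying 2B₀C₁B₃ε₁ ≤ ε₄ Eq. (111) has exactly one solution in the space (115).
This solution satisfies the bounds (115) with ε₄ = 3B₀C₁B₃ε₁. Moreover, if we replace the configuration H₁B by an arbitrary configuration 𝔄 … satisfying the same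
bounds as H₁B, then the above statement is again true»*; (111) p. 294 *«A₁ + 𝔊J + 𝔊((δ/δA′)V)(A₁ + H₁B) = 0»*; (117) p. 295 *«By Theorem 3.13 of [5] …»*.

THE OBJECTS (RULING g25-№1 §C (S2), agreed with ★w5-20520's probe: `Pd ≡ sitesPerDir 0`, `η = L^{−(K−n)}`, `lev₀ ≡ lev₁ ≡ K − n`).  For a member `(F, n, K)` of the
route (`T3ContinuumYM3Torus.T3Family`, lattice `F.P K`, `d = (F.P K).d = 3`): lit-balaban's periodic lattice is `TSite d Pd`, `Pd ≡ (F.P K).sitesPerDir 0`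
(`B4Sect5Torus`, `B9SectCLatticeCarrier.Bond d Pd = TSite × Fin d`); the site chart is an ABSTRACT `e : Site (F.P K) 0 ≃ TSite d Pd` intertwining the unit
steps (`he : e (x + e_μ) = shiftEquiv μ (e x)`; the chart of record `ZMod ↔ Fin` is ★w5's file and discharges `e`, `he` by `exact`); the background is READ on
lit-balaban's bonds as the lambda **`b ↦ unitsField (toUField U₀) ⟨e⁻¹ b.1, b.2⟩`** (`SU(2) ≤ U(2) → M₂(ℂ)ˣ`, `B10Eq27TorusAxialLog`) — no definition is
introduced; the scale letters are `L := F.L`, `η := L^{−(K−n)}` (`T3SectALandauChart.eta`), and the level maps are CONSTANT `≡ K − n` (pure small-field problem: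
every `Ω_j` is the whole torus, so the binding level is the top one and `levWeight L η lev 1 ≡ L^{K−n}·L^{−(K−n)} = 1`: the (115) norm is `max{sup‖A‖, sup‖∇_{U₀}A‖}`
in `A`-units, `X = ηA` being the exponent of (19)/(112) of the Summit-side letters `Prop7TPrint.nMax19`).

WHAT IS PROVED (sorry-free, no definition; [folklore] bookkeeping except where cited).
* §1 `isUnitaryBg_T3` (`B11Prop6Concrete.IsUnitaryBg` of the reading: `U₀(b)⁻¹ = U₀(b)^*`, by `rfl`); the chart rows `tsh_apply`, `tsh_symm_apply`
  (lit-balaban's shifts `B11Eq90V0primeCurrent.Tsh` under `e`), `plaqU_chart` (`B9Eq39Adjoint.plaqU` of the reading = the torus transport `holT … (plaqWord μ ν)`),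
  **`divP_chart`**: lit-balaban's covariant divergence of the plaquette field `B9Eq39Adjoint.divP Tsh (Ucur ·) (B11Eq27Current.plaqField …) μ (e x)` IS the route's
  `B10Eq68TorusRegularity.covDivT 1 (unitsField (toUField U₀)) μ x` ([Balaban1985RegularSpaces] (1.1)–(1.2) = [Balaban1985BackgroundPropagators] (3.8)–(3.9): the
  same backward covariant derivative and the same `ν < μ ∕ ν > μ` signs on both sides).
* §2 **`inU2cur_of_divSmall`** ∕ **`inU2cur_of_regPr`**: the route's divergence clause `T3PrintedRegularMinimiser.DivSmall F n K a U₀` (`‖(D^{1*}_U∂U)(b)‖ < a·L^{−3(K−n)}`),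
  resp. `RegPr F n K a U₀`, gives lit-balaban's (2)/(14) current clause `B11Prop6Concrete.InU2cur L η lev₀ a (reading)` (`‖(D^{η*}_U∂U)(b)‖ ≤ a·η²·(Lʲη)⁻³`, here
  `= a·η²`) — the hypothesis `h14` of `B11Prop6Concrete.exists_solution_concrete` ∕ `B11Eq98CurrentSlot.norm_Jcur_le` ((28) DERIVED there).
* §3 **`prop6_T3`** = `B11Prop6Concrete.exists_solution_concrete` AT THESE OBJECTS: for `U₀ ∈ 𝔘_k(C₁B₃ε₁)` in full (`RegPr`), letters `𝒢 = 𝔊(U₀)` with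
  ‖𝒢f‖₍₁₁₅₎ ≤ B₀‖f‖₍₋₃₎ (= `SectEDatum.norm_G`, [Balaban1985BackgroundPropagators] Thm 3.13 — N06(d = 3), DISPLAYED), `W = (δ/δA′)V` quadratic-analytic with (C₄, a₃)
  (= Prop. 4 (97)–(98), DISPLAYED; lattice-free discharge `B11Ineq98W80LatticeFree` is the next file per RULING g25-№1 ADD. 2), `3L ≤ B₃`, `2B₀C₁B₃ε₁ ≤ ε₄`, `4ε₄ ≤ a₃`,
  `16B₀C₄ε₄ ≤ 1`, and a datum `𝔄` with ‖𝔄‖₍₁₁₅₎ < 6LB₀C₁ε₁: Eq. (111) with the CONCRETE current `J(U₀) = Jcur` has exactly one solution in the open (115)-ball `ε₄`, of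
  size < 3B₀C₁B₃ε₁; **`prop6_T3_H₁B`**: the same at `𝔄 := H₁(U₀)B` from ‖H₁(U₀)b‖₍₁₁₅₎ ≤ B₀‖b‖ (= `SectEDatum.norm_H₁`, [Balaban1985BackgroundPropagators] Thm 3.12 —
  N06(d = 3), DISPLAYED) and `|B| < 2dLC₁ε₁` ((20) ⇐ [Balaban1985RegularSpaces] (1.37), DISPLAYED).
* §4 AT THE CHART OF RECORD (`Prop7SectET3Transport.siteEquiv F K`, ★w5-20520 p595802; `e`, `he` discharged by `siteEquiv`, `siteEquiv_shiftEquiv`):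
  **`inU2cur_bgOfCfg_of_regPr`** and **`prop6_bgOfCfg`** — the same two rows for the background `bgOfCfg F K U₀ : Bond 3 (periodsT3 F K) → M₂(ℂ)ˣ` (no hypothesis
  on a chart left; these are the statements the (S2) instance ∕ (S3) files consume).
DEPMAP EDGE LANDED BY NAME: «P6@T³ ⇐ RegPr ∧ norm_G ∧ Prop4 (∧ norm_H₁ ∧ (20)-bound for the H₁B datum)».  NOT HERE (honest scope, RULING DE-CONFLICT (2)): C-min
(`Prop7ExistRouteAlphaMin`'s `hC`) ⇐ P6@T³ needs (i) the chart (47)/(101)/(112) at T³ ([Balaban1985Variational] Props 3, 5) and (ii) the minimality half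
(141)–(142) on the nonlinear fibre (★w4-19200's `growth142_T3`); the operator letters `frakGAt`/`H1LatticeCLM`/`W80` are not instantiated here (𝒢, W, H₁ are
universally quantified letters, exactly as in `B11Prop6Concrete` §2).

References: T. Bałaban, CMP 102 (1985) 277–309 [Balaban1985Variational] ((2) p.278, (14) p.280, (20) p.281, (28) p.282, (103) p.293, (111) p.294, (115)–(117) p.295,
Prop. 6 pp.295–296); CMP 99 (1985) 75–102 [Balaban1985RegularSpaces] ((1.1)–(1.2) p.76, (1.9) p.77, (1.37) p.82); CMP 99 (1985) 389–434
[Balaban1985BackgroundPropagators] ((3.3) p.390, (3.8)–(3.9) p.392, Thms 3.12–3.13 pp.420–423); CMP 98 (1985) 17–51 [Balaban1985Averaging] ((9) p.19, (19) p.21).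
-/

noncomputable section

open scoped Matrix.Norms.L2Operator

namespace Summit.QuantumFields.YangMills.Theorems.Prop7SectET3Objects

open Literature.MathematicalPhysics.QuantumFieldTheory.Balaban1983to89
open T3ContinuumYM3Torus T3PrintedRegularMinimiser
open B4Sect5Torus (TSite)
open B9SectCLatticeCarrier (Bond)
open B10Eq27TorusAxialLog (unitsField toUField val_unitsField holT holT_plaqWord)
open B10Eq68TorusRegularity (covDivT covDerivT plaqFT)
open B11Prop6Concrete (IsUnitaryBg InU2cur)
open B11Eq90V0primeCurrent (Tsh Ucur)
open B9Eq39Adjoint (R covDstar divP divPη plaqU)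
open B11Eq27Current (plaqField)
open B11Eq115Space (levWeight NegSize Space115)
open B11Eq111FrakG (nabla115)
open B11Eq98CurrentSlot (Jcur)
open B13Contraction113 (QuadAnalytic)
open B11Prop6Concrete (exists_solution_concrete exists_solution_concrete_H₁B)
open B7Eq78Linearization (conjR)

variable {F : T3Family} {n K : ℕ}

/-! ## §1 The background read on lit-balaban's bonds through a site chart -/

section Chart

variable (e : Site (F.P K) 0 ≃ TSite (F.P K).d (fun _ : Fin (F.P K).d => (F.P K).sitesPerDir 0))

/-- **The reading is G-valued, G = SU(2) ⊂ U(2)**: `U₀(b)⁻¹ = U₀(b)^*` bondwise — lit-balaban's `IsUnitaryBg` (the hypothesis `hU` of `norm_Jcur_le` ∕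
`exists_solution_concrete`), by `rfl` on `Unitary.toUnits`. [cite: Balaban1985Variational, p.277 («G ⊂ U(N)»), (28) p.282] -/
theorem isUnitaryBg_T3 (U₀ : GaugeField (F.P K) 0 (Matrix.specialUnitaryGroup (Fin 2) ℂ)) :
    IsUnitaryBg (fun b : Bond (F.P K).d (fun _ : Fin (F.P K).d => (F.P K).sitesPerDir 0) => unitsField (toUField U₀) ⟨e.symm b.1, b.2⟩) := by
  intro b
  rfl

/- The chart intertwines the unit steps: `e (x + e_μ) = (e x) + e_μ` (the ONE property of ★w5's chart of record used below). -/
variable (he : ∀ (x : Site (F.P K) 0) (μ : Fin (F.P K).d), e (x.shift μ) = B9Eq33CovDerivVector.shiftEquiv μ (e x))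

include he in
/-- lit-balaban's shift `T_μ` ([Balaban1985BackgroundPropagators] (3.3): `x ↦ x + e_μ`, `B11Eq90V0primeCurrent.Tsh`) read through the chart is the route's `Site.shift`.
[folklore] [cite: Balaban1985BackgroundPropagators, (3.3) p.390] -/
theorem tsh_apply (x : Site (F.P K) 0) (μ : Fin (F.P K).d) :
    Tsh (Pd := fun _ : Fin (F.P K).d => (F.P K).sitesPerDir 0) μ (e x) = e (x.shift μ) := by
  rw [he]

include he in
/-- … and its inverse `x ↦ x − e_μ` is the route's `Site.unshift`. [folklore] [cite: Balaban1985BackgroundPropagators, (3.5) p.391] -/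
theorem tsh_symm_apply (x : Site (F.P K) 0) (μ : Fin (F.P K).d) :
    (Tsh (Pd := fun _ : Fin (F.P K).d => (F.P K).sitesPerDir 0) μ).symm (e x) = e (x.unshift μ) := by
  rw [Equiv.symm_apply_eq, tsh_apply e he, Site.shift_unshift]

include he in
/-- **Plaquette variables agree**: lit-balaban's `U(∂p_{μν}(x)) = U_μ(x)U_ν(x+e_μ)U_μ(x+e_ν)⁻¹U_ν(x)⁻¹` (`B9Eq39Adjoint.plaqU`) of the reading, at `e x`, is the route's
transport along the plaquette word `(+e_μ, +e_ν, −e_μ, −e_ν)` from `x` (`B10Eq27TorusAxialLog.holT_plaqWord`). [cite: Balaban1985Averaging, (9) p.19; Balaban1985BackgroundPropagators, (3.1) p.390] -/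
theorem plaqU_chart (U₀ : GaugeField (F.P K) 0 (Matrix.specialUnitaryGroup (Fin 2) ℂ)) (μ ν : Fin (F.P K).d) (x : Site (F.P K) 0) :
    plaqU Tsh (Ucur (fun b : Bond (F.P K).d (fun _ : Fin (F.P K).d => (F.P K).sitesPerDir 0) => unitsField (toUField U₀) ⟨e.symm b.1, b.2⟩)) μ ν (e x)
      = holT (unitsField (toUField U₀)) x (B7Prop1Explicit.plaqWord μ ν) := by
  rw [holT_plaqWord]
  simp only [plaqU, Ucur, tsh_apply e he, Equiv.symm_apply_apply]

include he in
/-- **THE COVARIANT DIVERGENCE OF THE PLAQUETTE FIELD AGREES** (the one row with content): lit-balaban's (3.9) `(D^{1*}F)_μ(x) = Σ_{ν<μ}(D*_νF_{νμ})(x) −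
Σ_{ν>μ}(D*_νF_{μν})(x)` with the backward covariant derivative (3.8) `(D*_νG)(x) = R(U(x−e_ν, x)⁻¹)G(x−e_ν) − G(x)` applied to `F = ∂U₀` (`B9Eq39Adjoint.divP Tsh (Ucur ·)
(B11Eq27Current.plaqField …)`), evaluated at `e x`, IS the route's [Balaban1985RegularSpaces] (1.1)–(1.2) `B10Eq68TorusRegularity.covDivT 1 (unitsField (toUField U₀)) μ x`
— same signs, same transporter `R = conjR`, `η = 1`. [cite: Balaban1985BackgroundPropagators, (3.8)-(3.9) p.392; Balaban1985RegularSpaces, (1.1)-(1.2) p.76] -/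
theorem divP_chart (U₀ : GaugeField (F.P K) 0 (Matrix.specialUnitaryGroup (Fin 2) ℂ)) (μ : Fin (F.P K).d) (x : Site (F.P K) 0) :
    divP Tsh (Ucur (fun b : Bond (F.P K).d (fun _ : Fin (F.P K).d => (F.P K).sitesPerDir 0) => unitsField (toUField U₀) ⟨e.symm b.1, b.2⟩))
        (plaqField Tsh (Ucur (fun b : Bond (F.P K).d (fun _ : Fin (F.P K).d => (F.P K).sitesPerDir 0) => unitsField (toUField U₀) ⟨e.symm b.1, b.2⟩)))
        μ (e x)
      = covDivT 1 (unitsField (toUField U₀)) μ x := by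
  have hP : ∀ (κ κ' : Fin (F.P K).d) (y : Site (F.P K) 0),
      plaqField Tsh (Ucur (fun b : Bond (F.P K).d (fun _ : Fin (F.P K).d => (F.P K).sitesPerDir 0) => unitsField (toUField U₀) ⟨e.symm b.1, b.2⟩))
        κ κ' (e y) = plaqFT (unitsField (toUField U₀)) κ κ' y := by
    intro κ κ' y
    simp only [plaqField, plaqFT, plaqU_chart e he]
  have hD : ∀ (κ : Fin (F.P K).d) (G : Site (F.P K) 0 → Matrix (Fin 2) (Fin 2) ℂ)
      (G' : TSite (F.P K).d (fun _ : Fin (F.P K).d => (F.P K).sitesPerDir 0) → Matrix (Fin 2) (Fin 2) ℂ),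
      (∀ y, G' (e y) = G y) →
      covDstar Tsh (Ucur (fun b : Bond (F.P K).d (fun _ : Fin (F.P K).d => (F.P K).sitesPerDir 0) => unitsField (toUField U₀) ⟨e.symm b.1, b.2⟩))
        κ G' (e x) = covDerivT 1 (unitsField (toUField U₀)) κ G x := by
    intro κ G G' hG
    simp only [covDstar, covDerivT, Ucur, tsh_symm_apply e he, Equiv.symm_apply_apply, hG, inv_one, one_smul]
    rfl
  rw [covDivT, ← Finset.filter_gt_eq_Iio, ← Finset.filter_lt_eq_Ioi, Finset.sum_filter, Finset.sum_filter, divP]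
  congr 1
  · refine Finset.sum_congr rfl fun ν _ => ?_
    split_ifs with h
    · exact hD ν _ _ (hP ν μ)
    · rfl
  · refine Finset.sum_congr rfl fun ν _ => ?_
    split_ifs with h
    · exact hD ν _ _ (hP μ ν)
    · rfl

/-! ## §2 The (14)-current clause `InU2cur` from the route's divergence clause `DivSmall` -/

include he in
/-- **(2)/(14)'s CURRENT CLAUSE AT THE T³ OBJECTS**: the route's divergence clause `DivSmall F n K a U₀` (`‖(D^{1*}_{U₀}∂U₀)(b)‖ < a·L^{−3(K−n)}` at every bond of
the finest lattice, [Balaban1985RegularSpaces] (1.9) at the top scale) gives lit-balaban's `InU2cur L η lev₀ a (reading)` — *«|(D*_U∂U)(b)| < ε₀η²(Lʲη)⁻³ for b ∈ Ω_j»*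
read bondwise with `η = L^{−(K−n)}`, `lev₀ ≡ K − n` (so `(Lʲη)⁻³ = 1` and `η⁻¹·‖D^{1*}…‖ ≤ a·η²`). [cite: Balaban1985Variational, (2) p.278, (14) p.280; Balaban1985RegularSpaces, (1.9) p.77] -/
theorem inU2cur_of_divSmall {a : ℝ} (U₀ : GaugeField (F.P K) 0 (Matrix.specialUnitaryGroup (Fin 2) ℂ)) (h : DivSmall F n K a U₀) :
    InU2cur (F.L : ℝ) (((F.L : ℝ)⁻¹) ^ (K - n)) (fun _ : Bond (F.P K).d (fun _ : Fin (F.P K).d => (F.P K).sitesPerDir 0) => K - n) a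
      (fun b : Bond (F.P K).d (fun _ : Fin (F.P K).d => (F.P K).sitesPerDir 0) => unitsField (toUField U₀) ⟨e.symm b.1, b.2⟩) := by
  intro b
  obtain ⟨y, μ⟩ := b
  obtain ⟨x, rfl⟩ : ∃ x, e x = y := ⟨e.symm y, e.apply_symm_apply y⟩
  have hL : (0 : ℝ) < (F.L : ℝ) := by have := F.hL.2; exact_mod_cast (by omega : 0 < F.L)
  have hη : (0 : ℝ) < ((F.L : ℝ)⁻¹) ^ (K - n) := by positivity
  rw [divPη, divP_chart e he U₀ μ x, norm_smul, norm_inv, Complex.norm_real, Real.norm_of_nonneg hη.le,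
    B11Eq115Space.levWeight_apply, pow_one]
  have hw : (F.L : ℝ) ^ (K - n) * ((F.L : ℝ)⁻¹) ^ (K - n) = 1 := by
    rw [← mul_pow, mul_inv_cancel₀ hL.ne', one_pow]
  rw [hw, inv_one, one_pow, mul_one]
  have hb : ‖covDivT 1 (unitsField (toUField U₀)) μ x‖ ≤ a * (((F.L : ℝ)⁻¹) ^ (K - n)) ^ 3 := by
    have h' := (h ⟨x, μ⟩).le
    rwa [pow_mul'] at h'
  calc (((F.L : ℝ)⁻¹) ^ (K - n))⁻¹ * ‖covDivT 1 (unitsField (toUField U₀)) μ x‖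
      ≤ (((F.L : ℝ)⁻¹) ^ (K - n))⁻¹ * (a * (((F.L : ℝ)⁻¹) ^ (K - n)) ^ 3) :=
        mul_le_mul_of_nonneg_left hb (inv_nonneg.2 hη.le)
    _ = a * (((F.L : ℝ)⁻¹) ^ (K - n)) ^ 2 := by
        field_simp

include he in
/-- **`U₀ ∈ 𝔘_k(a)` IN FULL (`RegPr F n K a U₀`) puts the reading in lit-balaban's current class (2) of radius `a`** (its divergence half; the plaquette half is
not used by Sect. E). [cite: Balaban1985Variational, (2) p.278, (14) p.280] -/
theorem inU2cur_of_regPr {a : ℝ} (U₀ : GaugeField (F.P K) 0 (Matrix.specialUnitaryGroup (Fin 2) ℂ)) (h : RegPr F n K a U₀) :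
    InU2cur (F.L : ℝ) (((F.L : ℝ)⁻¹) ^ (K - n)) (fun _ : Bond (F.P K).d (fun _ : Fin (F.P K).d => (F.P K).sitesPerDir 0) => K - n) a
      (fun b : Bond (F.P K).d (fun _ : Fin (F.P K).d => (F.P K).sitesPerDir 0) => unitsField (toUField U₀) ⟨e.symm b.1, b.2⟩) :=
  inU2cur_of_divSmall e he U₀ h.divSmall

/-! ## §3 Proposition 6 ([Balaban1985Variational] p. 295) AT THE T³ OBJECTS, the curved letters displayed -/

omit he in
/-- `dL ≤ B₃` at `d = (F.P K).d = 3` (the located condition of `B11Prop6Scheme.prop6_solution`; true for the B₃ of (162), and implied by the crux's `3L ≤ B₃`).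
[cite: Balaban1985Variational, (162) p.303, Prop. 6 p.295] -/
theorem three_L_cast {B₃ : ℝ} (h : (3 : ℝ) * F.L ≤ B₃) : ((F.P K).d : ℝ) * (F.L : ℝ) ≤ B₃ := by
  simpa using h

include he in
/-- **PROPOSITION 6 (i)/(ii) AT THE T³ OBJECTS OF THE ROUTE** (`B11Prop6Concrete.exists_solution_concrete` with `hU`, `h14` DISCHARGED from `RegPr F n K (C₁B₃ε₁) U₀`):
for the letters `𝒢 = 𝔊(U₀) : |·|₍₋₃₎ → (115)_{U₀}` with ‖𝒢f‖ ≤ B₀‖f‖ (*«By Theorem 3.13 of [5]»*, (117) — `SectEDatum.norm_G`, N06(d = 3), DISPLAYED as `h𝒢`),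
`W = (δ/δA′)V` quadratic-analytic with `(C₄, a₃)` (Prop. 4 (97)–(98), DISPLAYED as `hW`), constants with `3L ≤ B₃`, `2B₀C₁B₃ε₁ ≤ ε₄`, `4ε₄ ≤ a₃`, `16B₀C₄ε₄ ≤ 1`
(`ε₄ ≤ a₄` unfolded), and any `𝔄 ∈ (115)_{U₀}` with ‖𝔄‖ < 2·3L·B₀C₁ε₁ ((103)): Eq. (111) `A₁ + 𝒢J(U₀) + 𝒢(W(A₁ + 𝔄)) = 0` with the CONCRETE current `J(U₀) = Jcur`
((28) derived in lit-balaban) has a solution in the open (115)-ball of radius `ε₄`, of size `< 3B₀C₁B₃ε₁`, and every solution in that ball equals it.  Scale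
letters `L = F.L`, `η = L^{−(K−n)}`, `lev ≡ K − n`; the two `Fact`s are `0 < L`, `0 < η`. [cite: Balaban1985Variational, Prop. 6 p.295, (111) p.294, (117) p.295] -/
theorem prop6_T3 [Fact (0 < (F.L : ℝ))] [Fact (0 < ((F.L : ℝ)⁻¹) ^ (K - n))] {B₀ C₄ a₃ C₁ B₃ ε₁ ε₄ : ℝ}
    (U₀ : GaugeField (F.P K) 0 (Matrix.specialUnitaryGroup (Fin 2) ℂ))
    {𝒢 : NegSize (F.L : ℝ) (((F.L : ℝ)⁻¹) ^ (K - n)) (fun _ : Bond (F.P K).d (fun _ : Fin (F.P K).d => (F.P K).sitesPerDir 0) => K - n) 3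
            (Matrix (Fin 2) (Fin 2) ℂ) →L[ℂ]
          Space115 (F.L : ℝ) (((F.L : ℝ)⁻¹) ^ (K - n)) (fun _ : Bond (F.P K).d (fun _ : Fin (F.P K).d => (F.P K).sitesPerDir 0) => K - n)
            (fun _ : Bond (F.P K).d (fun _ : Fin (F.P K).d => (F.P K).sitesPerDir 0) × Fin (F.P K).d => K - n)
            (nabla115 (((F.L : ℝ)⁻¹) ^ (K - n))
              (fun b : Bond (F.P K).d (fun _ : Fin (F.P K).d => (F.P K).sitesPerDir 0) => unitsField (toUField U₀) ⟨e.symm b.1, b.2⟩))}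
    {W : Space115 (F.L : ℝ) (((F.L : ℝ)⁻¹) ^ (K - n)) (fun _ : Bond (F.P K).d (fun _ : Fin (F.P K).d => (F.P K).sitesPerDir 0) => K - n)
            (fun _ : Bond (F.P K).d (fun _ : Fin (F.P K).d => (F.P K).sitesPerDir 0) × Fin (F.P K).d => K - n)
            (nabla115 (((F.L : ℝ)⁻¹) ^ (K - n))
              (fun b : Bond (F.P K).d (fun _ : Fin (F.P K).d => (F.P K).sitesPerDir 0) => unitsField (toUField U₀) ⟨e.symm b.1, b.2⟩)) →
          NegSize (F.L : ℝ) (((F.L : ℝ)⁻¹) ^ (K - n)) (fun _ : Bond (F.P K).d (fun _ : Fin (F.P K).d => (F.P K).sitesPerDir 0) => K - n) 3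
            (Matrix (Fin 2) (Fin 2) ℂ)}
    (h𝒢 : ∀ f, ‖𝒢 f‖ ≤ B₀ * ‖f‖) (hW : QuadAnalytic W C₄ a₃) (hB₀ : 0 < B₀) (hC₄ : 0 < C₄) (hC₁ : 0 < C₁) (hB₃ : 0 < B₃) (hε₁ : 0 < ε₁)
    (hdLB₃ : (3 : ℝ) * F.L ≤ B₃) (h1 : 2 * B₀ * C₁ * B₃ * ε₁ ≤ ε₄) (h2 : 4 * ε₄ ≤ a₃) (h3 : 16 * B₀ * C₄ * ε₄ ≤ 1)
    (hreg : RegPr F n K (C₁ * B₃ * ε₁) U₀)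
    {𝔄 : Space115 (F.L : ℝ) (((F.L : ℝ)⁻¹) ^ (K - n)) (fun _ : Bond (F.P K).d (fun _ : Fin (F.P K).d => (F.P K).sitesPerDir 0) => K - n)
            (fun _ : Bond (F.P K).d (fun _ : Fin (F.P K).d => (F.P K).sitesPerDir 0) × Fin (F.P K).d => K - n)
            (nabla115 (((F.L : ℝ)⁻¹) ^ (K - n))
              (fun b : Bond (F.P K).d (fun _ : Fin (F.P K).d => (F.P K).sitesPerDir 0) => unitsField (toUField U₀) ⟨e.symm b.1, b.2⟩))}
    (h𝔄 : ‖𝔄‖ < 2 * ((3 : ℝ) * F.L) * B₀ * C₁ * ε₁) :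
    ∃ A₁ : Space115 (F.L : ℝ) (((F.L : ℝ)⁻¹) ^ (K - n)) (fun _ : Bond (F.P K).d (fun _ : Fin (F.P K).d => (F.P K).sitesPerDir 0) => K - n)
            (fun _ : Bond (F.P K).d (fun _ : Fin (F.P K).d => (F.P K).sitesPerDir 0) × Fin (F.P K).d => K - n)
            (nabla115 (((F.L : ℝ)⁻¹) ^ (K - n))
              (fun b : Bond (F.P K).d (fun _ : Fin (F.P K).d => (F.P K).sitesPerDir 0) => unitsField (toUField U₀) ⟨e.symm b.1, b.2⟩)),
      ‖A₁‖ < ε₄ ∧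
      A₁ + 𝒢 (Jcur fun b : Bond (F.P K).d (fun _ : Fin (F.P K).d => (F.P K).sitesPerDir 0) => unitsField (toUField U₀) ⟨e.symm b.1, b.2⟩)
          + 𝒢 (W (A₁ + 𝔄)) = 0 ∧
      ‖A₁‖ < 3 * B₀ * C₁ * B₃ * ε₁ ∧
      ∀ A₁' : Space115 (F.L : ℝ) (((F.L : ℝ)⁻¹) ^ (K - n)) (fun _ : Bond (F.P K).d (fun _ : Fin (F.P K).d => (F.P K).sitesPerDir 0) => K - n)
            (fun _ : Bond (F.P K).d (fun _ : Fin (F.P K).d => (F.P K).sitesPerDir 0) × Fin (F.P K).d => K - n)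
            (nabla115 (((F.L : ℝ)⁻¹) ^ (K - n))
              (fun b : Bond (F.P K).d (fun _ : Fin (F.P K).d => (F.P K).sitesPerDir 0) => unitsField (toUField U₀) ⟨e.symm b.1, b.2⟩)),
        ‖A₁'‖ < ε₄ →
        A₁' + 𝒢 (Jcur fun b : Bond (F.P K).d (fun _ : Fin (F.P K).d => (F.P K).sitesPerDir 0) => unitsField (toUField U₀) ⟨e.symm b.1, b.2⟩)
            + 𝒢 (W (A₁' + 𝔄)) = 0 →
        A₁' = A₁ := by
  have h𝔄' : ‖𝔄‖ < 2 * (((F.P K).d : ℝ) * (F.L : ℝ)) * B₀ * C₁ * ε₁ := by simpa using h𝔄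
  exact exists_solution_concrete _ h𝒢 hW hB₀ hC₄ hC₁ hB₃ hε₁ (three_L_cast hdLB₃) h1 h2 h3 (isUnitaryBg_T3 e U₀)
    (inU2cur_of_regPr e he U₀ hreg) h𝔄'

include he in
/-- **PROPOSITION 6 (i) AT THE T³ OBJECTS WITH THE DATUM `𝔄 := H₁(U₀)B`** (`B11Prop6Concrete.exists_solution_concrete_H₁B`): as `prop6_T3`, the letter
`H₁(U₀) : (β → M₂(ℂ)) → (115)_{U₀}` with ‖H₁(U₀)b‖ ≤ B₀‖b‖ ([Balaban1985BackgroundPropagators] Thm 3.12 as used in (103) — `SectEDatum.norm_H₁`, N06(d = 3), DISPLAYED as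
`hH₁`) and the constraint configuration `B` of (20) with `|B| < 2·3L·C₁ε₁` (*«hence |B| < 2dLC₁ε₁»* ⇐ [Balaban1985RegularSpaces] (1.37), DISPLAYED as `hB`; `β` = the
coarse bonds carrying `B`, abstract): Eq. (111) *«A₁ + 𝔊J + 𝔊((δ/δA′)V)(A₁ + H₁B) = 0»* has exactly one solution in the (115)-ball `ε₄`, of size `< 3B₀C₁B₃ε₁` ((103)
derived in lit-balaban). [cite: Balaban1985Variational, Prop. 6 p.295, (103) p.293, (20) p.281] -/
theorem prop6_T3_H₁B [Fact (0 < (F.L : ℝ))] [Fact (0 < ((F.L : ℝ)⁻¹) ^ (K - n))] {B₀ C₄ a₃ C₁ B₃ ε₁ ε₄ : ℝ}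
    (U₀ : GaugeField (F.P K) 0 (Matrix.specialUnitaryGroup (Fin 2) ℂ))
    {𝒢 : NegSize (F.L : ℝ) (((F.L : ℝ)⁻¹) ^ (K - n)) (fun _ : Bond (F.P K).d (fun _ : Fin (F.P K).d => (F.P K).sitesPerDir 0) => K - n) 3
            (Matrix (Fin 2) (Fin 2) ℂ) →L[ℂ]
          Space115 (F.L : ℝ) (((F.L : ℝ)⁻¹) ^ (K - n)) (fun _ : Bond (F.P K).d (fun _ : Fin (F.P K).d => (F.P K).sitesPerDir 0) => K - n)
            (fun _ : Bond (F.P K).d (fun _ : Fin (F.P K).d => (F.P K).sitesPerDir 0) × Fin (F.P K).d => K - n)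
            (nabla115 (((F.L : ℝ)⁻¹) ^ (K - n))
              (fun b : Bond (F.P K).d (fun _ : Fin (F.P K).d => (F.P K).sitesPerDir 0) => unitsField (toUField U₀) ⟨e.symm b.1, b.2⟩))}
    {W : Space115 (F.L : ℝ) (((F.L : ℝ)⁻¹) ^ (K - n)) (fun _ : Bond (F.P K).d (fun _ : Fin (F.P K).d => (F.P K).sitesPerDir 0) => K - n)
            (fun _ : Bond (F.P K).d (fun _ : Fin (F.P K).d => (F.P K).sitesPerDir 0) × Fin (F.P K).d => K - n)
            (nabla115 (((F.L : ℝ)⁻¹) ^ (K - n))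
              (fun b : Bond (F.P K).d (fun _ : Fin (F.P K).d => (F.P K).sitesPerDir 0) => unitsField (toUField U₀) ⟨e.symm b.1, b.2⟩)) →
          NegSize (F.L : ℝ) (((F.L : ℝ)⁻¹) ^ (K - n)) (fun _ : Bond (F.P K).d (fun _ : Fin (F.P K).d => (F.P K).sitesPerDir 0) => K - n) 3
            (Matrix (Fin 2) (Fin 2) ℂ)}
    (h𝒢 : ∀ f, ‖𝒢 f‖ ≤ B₀ * ‖f‖) (hW : QuadAnalytic W C₄ a₃) (hB₀ : 0 < B₀) (hC₄ : 0 < C₄) (hC₁ : 0 < C₁) (hB₃ : 0 < B₃) (hε₁ : 0 < ε₁)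
    (hdLB₃ : (3 : ℝ) * F.L ≤ B₃) (h1 : 2 * B₀ * C₁ * B₃ * ε₁ ≤ ε₄) (h2 : 4 * ε₄ ≤ a₃) (h3 : 16 * B₀ * C₄ * ε₄ ≤ 1)
    (hreg : RegPr F n K (C₁ * B₃ * ε₁) U₀)
    {β : Type} [Fintype β]
    (H₁ : (β → Matrix (Fin 2) (Fin 2) ℂ) →L[ℂ]
          Space115 (F.L : ℝ) (((F.L : ℝ)⁻¹) ^ (K - n)) (fun _ : Bond (F.P K).d (fun _ : Fin (F.P K).d => (F.P K).sitesPerDir 0) => K - n)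
            (fun _ : Bond (F.P K).d (fun _ : Fin (F.P K).d => (F.P K).sitesPerDir 0) × Fin (F.P K).d => K - n)
            (nabla115 (((F.L : ℝ)⁻¹) ^ (K - n))
              (fun b : Bond (F.P K).d (fun _ : Fin (F.P K).d => (F.P K).sitesPerDir 0) => unitsField (toUField U₀) ⟨e.symm b.1, b.2⟩)))
    (hH₁ : ∀ b, ‖H₁ b‖ ≤ B₀ * ‖b‖) {B : β → Matrix (Fin 2) (Fin 2) ℂ} (hB : ‖B‖ < 2 * ((3 : ℝ) * F.L) * (C₁ * ε₁)) :
    ∃ A₁ : Space115 (F.L : ℝ) (((F.L : ℝ)⁻¹) ^ (K - n)) (fun _ : Bond (F.P K).d (fun _ : Fin (F.P K).d => (F.P K).sitesPerDir 0) => K - n)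
            (fun _ : Bond (F.P K).d (fun _ : Fin (F.P K).d => (F.P K).sitesPerDir 0) × Fin (F.P K).d => K - n)
            (nabla115 (((F.L : ℝ)⁻¹) ^ (K - n))
              (fun b : Bond (F.P K).d (fun _ : Fin (F.P K).d => (F.P K).sitesPerDir 0) => unitsField (toUField U₀) ⟨e.symm b.1, b.2⟩)),
      ‖A₁‖ < ε₄ ∧
      A₁ + 𝒢 (Jcur fun b : Bond (F.P K).d (fun _ : Fin (F.P K).d => (F.P K).sitesPerDir 0) => unitsField (toUField U₀) ⟨e.symm b.1, b.2⟩)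
          + 𝒢 (W (A₁ + H₁ B)) = 0 ∧
      ‖A₁‖ < 3 * B₀ * C₁ * B₃ * ε₁ ∧
      ∀ A₁' : Space115 (F.L : ℝ) (((F.L : ℝ)⁻¹) ^ (K - n)) (fun _ : Bond (F.P K).d (fun _ : Fin (F.P K).d => (F.P K).sitesPerDir 0) => K - n)
            (fun _ : Bond (F.P K).d (fun _ : Fin (F.P K).d => (F.P K).sitesPerDir 0) × Fin (F.P K).d => K - n)
            (nabla115 (((F.L : ℝ)⁻¹) ^ (K - n))
              (fun b : Bond (F.P K).d (fun _ : Fin (F.P K).d => (F.P K).sitesPerDir 0) => unitsField (toUField U₀) ⟨e.symm b.1, b.2⟩)),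
        ‖A₁'‖ < ε₄ →
        A₁' + 𝒢 (Jcur fun b : Bond (F.P K).d (fun _ : Fin (F.P K).d => (F.P K).sitesPerDir 0) => unitsField (toUField U₀) ⟨e.symm b.1, b.2⟩)
            + 𝒢 (W (A₁' + H₁ B)) = 0 →
        A₁' = A₁ := by
  have hB' : ‖B‖ < 2 * (((F.P K).d : ℝ) * (F.L : ℝ)) * (C₁ * ε₁) := by simpa using hB
  exact exists_solution_concrete_H₁B _ h𝒢 hW hB₀ hC₄ hC₁ hB₃ hε₁ (three_L_cast hdLB₃) h1 h2 h3 (isUnitaryBg_T3 e U₀)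
    (inU2cur_of_regPr e he U₀ hreg) H₁ hH₁ hB'

end Chart

/-! ## §4 At the chart of record `Prop7SectET3Transport.siteEquiv F K` (★w5-20520, p595802): the background `bgOfCfg F K U₀` -/

section Record

open Summit.QuantumFields.YangMills.Theorems.Prop7SectET3Transport (periodsT3 siteEquiv siteEquiv_shiftEquiv bgOfCfg)

variable (F K)

/-- **(2)/(14)'s CURRENT CLAUSE AT THE CHART OF RECORD**: `RegPr F n K a U₀` puts `bgOfCfg F K U₀` (★w5's reading, `= fun b ↦ unitsField (toUField U₀) ⟨e⁻¹ b.1, b.2⟩`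
at `e := siteEquiv F K`, `rfl`) in lit-balaban's current class `InU2cur L η (lev ≡ K − n) a`, `η = L^{−(K−n)}`. [cite: Balaban1985Variational, (2) p.278, (14) p.280] -/
theorem inU2cur_bgOfCfg_of_regPr (n : ℕ) {a : ℝ} (U₀ : GaugeField (F.P K) 0 (Matrix.specialUnitaryGroup (Fin 2) ℂ)) (h : RegPr F n K a U₀) :
    InU2cur (F.L : ℝ) (((F.L : ℝ)⁻¹) ^ (K - n)) (fun _ : Bond 3 (periodsT3 F K) => K - n) a (bgOfCfg F K U₀) :=
  inU2cur_of_regPr (siteEquiv F K) (fun x μ => siteEquiv_shiftEquiv F K x μ) U₀ h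

/-- **PROPOSITION 6 (i)/(ii) AT THE CHART OF RECORD** — `prop6_T3` at `e := siteEquiv F K`, background `bgOfCfg F K U₀`, lattice `TSite 3 (periodsT3 F K)`, levels
`≡ K − n`, `η = L^{−(K−n)}`; letters `𝒢 = 𝔊(U₀)` (‖𝒢f‖ ≤ B₀‖f‖, N06(d = 3), DISPLAYED) and `W = (δ/δA′)V` (Prop. 4, DISPLAYED), `U₀ ∈ 𝔘_k(C₁B₃ε₁)` in full (`RegPr`).
[cite: Balaban1985Variational, Prop. 6 p.295, (111) p.294, (117) p.295] -/
theorem prop6_bgOfCfg (n : ℕ) [Fact (0 < (F.L : ℝ))] [Fact (0 < ((F.L : ℝ)⁻¹) ^ (K - n))] {B₀ C₄ a₃ C₁ B₃ ε₁ ε₄ : ℝ}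
    (U₀ : GaugeField (F.P K) 0 (Matrix.specialUnitaryGroup (Fin 2) ℂ))
    {𝒢 : NegSize (F.L : ℝ) (((F.L : ℝ)⁻¹) ^ (K - n)) (fun _ : Bond 3 (periodsT3 F K) => K - n) 3 (Matrix (Fin 2) (Fin 2) ℂ) →L[ℂ]
          Space115 (F.L : ℝ) (((F.L : ℝ)⁻¹) ^ (K - n)) (fun _ : Bond 3 (periodsT3 F K) => K - n) (fun _ : Bond 3 (periodsT3 F K) × Fin 3 => K - n)
            (nabla115 (((F.L : ℝ)⁻¹) ^ (K - n)) (bgOfCfg F K U₀))}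
    {W : Space115 (F.L : ℝ) (((F.L : ℝ)⁻¹) ^ (K - n)) (fun _ : Bond 3 (periodsT3 F K) => K - n) (fun _ : Bond 3 (periodsT3 F K) × Fin 3 => K - n)
            (nabla115 (((F.L : ℝ)⁻¹) ^ (K - n)) (bgOfCfg F K U₀)) →
          NegSize (F.L : ℝ) (((F.L : ℝ)⁻¹) ^ (K - n)) (fun _ : Bond 3 (periodsT3 F K) => K - n) 3 (Matrix (Fin 2) (Fin 2) ℂ)}
    (h𝒢 : ∀ f, ‖𝒢 f‖ ≤ B₀ * ‖f‖) (hW : QuadAnalytic W C₄ a₃) (hB₀ : 0 < B₀) (hC₄ : 0 < C₄) (hC₁ : 0 < C₁) (hB₃ : 0 < B₃) (hε₁ : 0 < ε₁)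
    (hdLB₃ : (3 : ℝ) * F.L ≤ B₃) (h1 : 2 * B₀ * C₁ * B₃ * ε₁ ≤ ε₄) (h2 : 4 * ε₄ ≤ a₃) (h3 : 16 * B₀ * C₄ * ε₄ ≤ 1)
    (hreg : RegPr F n K (C₁ * B₃ * ε₁) U₀)
    {𝔄 : Space115 (F.L : ℝ) (((F.L : ℝ)⁻¹) ^ (K - n)) (fun _ : Bond 3 (periodsT3 F K) => K - n) (fun _ : Bond 3 (periodsT3 F K) × Fin 3 => K - n)
            (nabla115 (((F.L : ℝ)⁻¹) ^ (K - n)) (bgOfCfg F K U₀))}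
    (h𝔄 : ‖𝔄‖ < 2 * ((3 : ℝ) * F.L) * B₀ * C₁ * ε₁) :
    ∃ A₁ : Space115 (F.L : ℝ) (((F.L : ℝ)⁻¹) ^ (K - n)) (fun _ : Bond 3 (periodsT3 F K) => K - n) (fun _ : Bond 3 (periodsT3 F K) × Fin 3 => K - n)
            (nabla115 (((F.L : ℝ)⁻¹) ^ (K - n)) (bgOfCfg F K U₀)),
      ‖A₁‖ < ε₄ ∧ A₁ + 𝒢 (Jcur (bgOfCfg F K U₀)) + 𝒢 (W (A₁ + 𝔄)) = 0 ∧ ‖A₁‖ < 3 * B₀ * C₁ * B₃ * ε₁ ∧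
      ∀ A₁' : Space115 (F.L : ℝ) (((F.L : ℝ)⁻¹) ^ (K - n)) (fun _ : Bond 3 (periodsT3 F K) => K - n) (fun _ : Bond 3 (periodsT3 F K) × Fin 3 => K - n)
            (nabla115 (((F.L : ℝ)⁻¹) ^ (K - n)) (bgOfCfg F K U₀)),
        ‖A₁'‖ < ε₄ → A₁' + 𝒢 (Jcur (bgOfCfg F K U₀)) + 𝒢 (W (A₁' + 𝔄)) = 0 → A₁' = A₁ :=
  prop6_T3 (siteEquiv F K) (fun x μ => siteEquiv_shiftEquiv F K x μ) U₀ h𝒢 hW hB₀ hC₄ hC₁ hB₃ hε₁ hdLB₃ h1 h2 h3 hreg h𝔄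

end Record

end Summit.QuantumFields.YangMills.Theorems.Prop7SectET3Objects

end
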